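import Summits.QuantumFields.YangMills.Theorems.BalabanUVNodesPortU8ImagesInfVol
import Summits.QuantumFields.YangMills.Theorems.BalabanUVNodesPortU8LocUnivLapKernelRow
import Summits.QuantumFields.YangMills.Theorems.BalabanUVNodesPortU8LocUnivDecayClause4
import Summits.QuantumFields.YangMills.Theorems.BalabanUVNodesPortU8LocUnivDecayClause2

/-!
# Port piece U8 — THE METHOD OF IMAGES, FILE 3b: THE INFINITE-VOLUME BOUNDS OF THE DIFFERENCE, LAPLACIAN AND CURL STENCIL KERNELS (PORT-PLAN-v4 §3, companion of file 3a)
# `|Re kerDiff(a + n·z)| ≤ (L^{k+1})⁻¹·MD163(4)·periodConst·e^{−κ|z|_∞}`, `|Re kerLap(a + n·z)|, |Re kerCurl(a + n·z)| ≤ C·η²·e^{−δ|z|_∞}` — extracted by `M → ∞` from the tree's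
# volume-uniform torus rows ✓`abs_windowResp_univ_shift_sub_le` ([B5] (1.63) Hölder), ✓`abs_lapStencil_windowResp_univ_le` (p22's [B6] (2.130)∕Prop. 2.5 row),
# ✓`abs_curlCurl_windowResp_univ_le` (r03's [B6] (2.148)∕(2.150) rows)

Cell `ym-nodeO-ideate` ∕ `ym-balaban-port`, porter `ymgap-nodeO-port-PTB-1` (gen 5).  JOIN-side helper for **stmt-QuantumFields-27238** (K0ᴬ), `--supports … --as helper`.
[B5] = [Balaban1984PropagatorsI], [B6] = [Balaban1984PropagatorsII], [15] = [Balaban1985Variational].  Same template as file 3a's ★★★`norm_re_imgKer_le`: realise `(a, z)` on every large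
volume (`realised_config`), read the stencil of `windowResp F k K univ` as the periodisation of the real kernel (file 2b), bound it by the row at torus distance `|z|_∞`, and extract
(`norm_le_of_rows`).  No new estimate of Bałaban is asserted.

WHAT IS PROVED (kernel, sorry-free): ★★★ `norm_re_kerDiff_le` (`j = 1`), ★★★ `norm_re_kerLap_le` (`j = 2`, constants `∃ δ > 0, C ≥ 0` of the Laplacian row), ★★★ `norm_re_kerCurl_le`
(`j = 2`, constants of the curl row) — uniform in the volume of reference `K₀`, in `k`, the offset and the directions.

HONEST FRAMING.  Bookkeeping over PROVED tree theorems; 27931 CLOSED·IMPLICATION-ONLY·IN TOTO unchanged; K0ᴬ 27238 OPEN; NODE O 0∕1; COUNT 8∕28 · K 1∕4 UNMOVED; finite `𝕋⁴_{L^K}` at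
fixed ε — NOT continuum ∕ OS ∕ Clay; **the Yang–Mills mass gap (Clay) is NOT proved.**
-/

noncomputable section

open scoped BigOperators

namespace Summit.QuantumFields.YangMills.Theorems.PortU8.Images

open Literature.MathematicalPhysics.QuantumFieldTheory.Balaban1983to89
open Literature.MathematicalPhysics.QuantumFieldTheory.Balaban1983to89.T4Continuum (T4Family)
open Literature.MathematicalPhysics.QuantumFieldTheory.Balaban1983to89.B4ContourShift (supNorm)
open Literature.MathematicalPhysics.QuantumFieldTheory.Balaban1983to89.B4TorusKernel (periodConst)
open Literature.MathematicalPhysics.QuantumFieldTheory.Balaban1983to89.B4TorusKernel.MultiPeriod (translate translate_apply torusSupNorm)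
open Literature.MathematicalPhysics.QuantumFieldTheory.Balaban1983to89.B5Hk163Decay (MG163 MG163_nonneg)
open Literature.MathematicalPhysics.QuantumFieldTheory.Balaban1983to89.B5Hk163Strip (kappa163 kappa163_pos)
open Literature.MathematicalPhysics.QuantumFieldTheory.Balaban1983to89.B5Hk163TorusHolderDecay (MD163)
open Literature.MathematicalPhysics.QuantumFieldTheory.Balaban1983to89.B5Prop11Plancherel (Tor fine)
open Literature.MathematicalPhysics.QuantumFieldTheory.Balaban1983to89.B5Eq117TorusCarriers (Mk EK)
open Literature.MathematicalPhysics.QuantumFieldTheory.Balaban1983to89.B5Eq118OneStroke (iterBlockOf)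
open Literature.MathematicalPhysics.QuantumFieldTheory.Balaban1983to89.B6LowerBound2153Torus (toT rep)
open Literature.MathematicalPhysics.QuantumFieldTheory.Balaban1983to89.B6BondElimination (unitVec unitVec_apply)
open Literature.MathematicalPhysics.QuantumFieldTheory.Balaban1983to89.B6SectAOperatorsV1 (dcE dcsE)
open Summit.QuantumFields.YangMills.Theorems.K0RecordFormatNames

variable (F : T4Family)

/-- The periodisation identity at the realised configuration, for a general stencil reading: if the stencil value `S` equals `Re Σ_m 𝒦((a + n·z + 0 − n·rep 0) + (nM)∘m)` and the
family `m ↦ 𝒦(a + n·(z + M∘m))` is summable, then `Σ_m Re 𝒦(a + n·(z + M∘m)) = S` as complex numbers. [folklore] -/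
theorem tsum_re_eq_of_stencil {k K' : ℕ} (𝒦 : (Fin (3 + 1) → ℤ) → ℂ) (a : Fin (3 + 1) → ℤ) (z : Fin (3 + 1) → ℤ) (S : ℝ)
    (hS : S = (∑' m : Fin (3 + 1) → ℤ, 𝒦 (translate (fine (d := 3 + 1) ((F.P K').L ^ (k + 1)) (Mk (F.P K') (k + 1)))
      (a + (((F.P K').L ^ (k + 1) : ℕ) : ℤ) • z + 0 - (((F.P K').L ^ (k + 1) : ℕ) : ℤ) • rep (d := 3 + 1) (Mk (F.P K') (k + 1)) (0 : Site (F.P K') (k + 1))) m)).re)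
    (hsum : Summable fun m : Fin (3 + 1) → ℤ => 𝒦 (translate (fine (d := 3 + 1) ((F.P K').L ^ (k + 1)) (Mk (F.P K') (k + 1)))
      (a + (((F.P K').L ^ (k + 1) : ℕ) : ℤ) • z + 0 - (((F.P K').L ^ (k + 1) : ℕ) : ℤ) • rep (d := 3 + 1) (Mk (F.P K') (k + 1)) (0 : Site (F.P K') (k + 1))) m)) :
    ∑' m : Fin (3 + 1) → ℤ, (((𝒦 (a + (((F.P K').L ^ (k + 1) : ℕ) : ℤ) • translate (Mk (F.P K') (k + 1)) z m)).re : ℝ) : ℂ) = ((S : ℝ) : ℂ) := by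
  rw [rep_zero_site', add_zero] at hS hsum
  have hsum' : Summable fun m : Fin (3 + 1) → ℤ => 𝒦 (a + (((F.P K').L ^ (k + 1) : ℕ) : ℤ) • translate (Mk (F.P K') (k + 1)) z m) :=
    hsum.congr fun m => by rw [translate_fine_offset]
  rw [hS, periodise_re (K := fun z' => 𝒦 (a + (((F.P K').L ^ (k + 1) : ℕ) : ℤ) • z')) (N := Mk (F.P K') (k + 1)) (x := z) hsum']
  congr 2
  exact tsum_congr fun m => by rw [translate_fine_offset]

/-- ★★★ **THE INFINITE-VOLUME FIRST-DIFFERENCE KERNEL DECAYS AT RATE `η`**: `|Re kerDiff n μ λ ν (a + n·z)| ≤ (L^{k+1})⁻¹·MD163(4)·periodConst(κ₁₆₃(4), 3)·e^{−(κ₁₆₃(4)∕4)|z|_∞}`,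
uniform in `k`, the offset, the directions — extracted from ✓`abs_windowResp_univ_shift_sub_le` on the volumes `K → ∞`. [cite: Balaban1984PropagatorsI, (1.63) p.28, (1.65)–(1.67) p.29, p.36 ll.20–23] -/
theorem norm_re_kerDiff_le (K₀ k : ℕ) (a : Fin (3 + 1) → Fin ((F.P K₀).L ^ (k + 1))) (μ lam ν : Fin (3 + 1)) (z : Fin (3 + 1) → ℤ) :
    ‖(((kerDiff ((F.P K₀).L ^ (k + 1)) μ lam ν ((fun j => ((a j : ℕ) : ℤ)) + (((F.P K₀).L ^ (k + 1) : ℕ) : ℤ) • z)).re : ℝ) : ℂ)‖ ≤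
      ((((F.P K₀).L : ℝ) ^ (k + 1))⁻¹) * (MD163 4 * periodConst (kappa163 4) 3 * Real.exp (-(kappa163 4 / (((3 : ℕ) : ℝ) + 1) * supNorm z))) := by
  refine norm_le_of_rows (F := F) (k := k)
    (fun z => (((kerDiff ((F.P K₀).L ^ (k + 1)) μ lam ν ((fun j => ((a j : ℕ) : ℤ)) + (((F.P K₀).L ^ (k + 1) : ℕ) : ℤ) • z)).re : ℝ) : ℂ))
    (norm_re_kerDiff_crude ((F.P K₀).L ^ (k + 1)) μ lam a ν) z fun K' hk2 hz => ?_
  obtain ⟨x, hx, hdist⟩ := realised_config (F := F) hk2 a z hz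
  have hk : k + 1 ≤ (F.P K').m + (F.P K').K := Nat.le_of_succ_le hk2
  have hval := diffStencil_windowResp_univ_eq F hk lam (0 : Site (F.P K') (k + 1)) x μ ν
    ((fun j => ((a j : ℕ) : ℤ)) + (((F.P K').L ^ (k + 1) : ℕ) : ℤ) • z) hx
  have hsum := ((summable_imgKer_translate_record F (K := K') (k := k) lam (0 : Site (F.P K') (k + 1)) μ
    ((fun j => ((a j : ℕ) : ℤ)) + (((F.P K').L ^ (k + 1) : ℕ) : ℤ) • z) (unitVec ν) (fun i => (abs_unitVec_le ν i).1)).sub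
    (summable_imgKer_translate_record F (K := K') (k := k) lam (0 : Site (F.P K') (k + 1)) μ
    ((fun j => ((a j : ℕ) : ℤ)) + (((F.P K').L ^ (k + 1) : ℕ) : ℤ) • z) 0 abs_zero_step_le))
  have hsum' : Summable fun m : Fin (3 + 1) → ℤ => kerDiff ((F.P K').L ^ (k + 1)) μ lam ν
      (translate (fine (d := 3 + 1) ((F.P K').L ^ (k + 1)) (Mk (F.P K') (k + 1)))
        ((fun j => ((a j : ℕ) : ℤ)) + (((F.P K').L ^ (k + 1) : ℕ) : ℤ) • z + 0 -
          (((F.P K').L ^ (k + 1) : ℕ) : ℤ) • rep (d := 3 + 1) (Mk (F.P K') (k + 1)) (0 : Site (F.P K') (k + 1))) m) := by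
    refine hsum.congr fun m => ?_
    simp only [kerDiff, translate_shift_eq, add_zero]
  have hval' := hval
  rw [show (fun j => ((a j : ℕ) : ℤ)) + (((F.P K').L ^ (k + 1) : ℕ) : ℤ) • z - (((F.P K').L ^ (k + 1) : ℕ) : ℤ) • rep (d := 3 + 1) (Mk (F.P K') (k + 1)) (0 : Site (F.P K') (k + 1)) =
      (fun j => ((a j : ℕ) : ℤ)) + (((F.P K').L ^ (k + 1) : ℕ) : ℤ) • z + 0 - (((F.P K').L ^ (k + 1) : ℕ) : ℤ) • rep (d := 3 + 1) (Mk (F.P K') (k + 1)) (0 : Site (F.P K') (k + 1))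
      by rw [add_zero]] at hval'
  have hper := tsum_re_eq_of_stencil F (kerDiff ((F.P K').L ^ (k + 1)) μ lam ν) (fun j => ((a j : ℕ) : ℤ)) z _ hval' hsum'
  have hrow := abs_windowResp_univ_shift_sub_le F hk (lam, (0 : Site (F.P K') (k + 1))) ⟨x, μ⟩ ν
  dsimp only at hrow
  rw [hdist] at hrow
  have hfinal : ‖((windowResp F k K' Finset.univ (lam, (0 : Site (F.P K') (k + 1))) ⟨x.shift ν, μ⟩ -
      windowResp F k K' Finset.univ (lam, (0 : Site (F.P K') (k + 1))) ⟨x, μ⟩ : ℝ) : ℂ)‖ ≤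
      ((((F.P K₀).L : ℝ) ^ (k + 1))⁻¹) * (MD163 4 * periodConst (kappa163 4) 3 * Real.exp (-(kappa163 4 / (((3 : ℕ) : ℝ) + 1) * supNorm z))) := by
    rw [Complex.norm_real, Real.norm_eq_abs]
    exact hrow
  exact (le_of_eq (congrArg _ hper)).trans hfinal

/-- ★★★ **THE INFINITE-VOLUME LAPLACIAN KERNEL DECAYS AT RATE `η²`**: with the constants `δ > 0`, `C ≥ 0` of ✓`abs_lapStencil_windowResp_univ_le` (p22's [B6] row, volume-uniform),
`|Re kerLap n μ λ (a + n·z)| ≤ C·η²·e^{−δ|z|_∞}`, `η = (L⁻¹)^{k+1}`, for every `k`, offset `a`, directions, `z ∈ ℤ⁴`. [cite: Balaban1984PropagatorsII, (2.130) p.246, Prop. 2.5 p.246; Balaban1984PropagatorsI, Prop. 1.2 (1.110) p.35, p.36 ll.20–23] -/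
theorem norm_re_kerLap_le : ∃ δ : ℝ, 0 < δ ∧ ∃ C : ℝ, 0 ≤ C ∧ ∀ (K₀ k : ℕ) (a : Fin (3 + 1) → Fin ((F.P K₀).L ^ (k + 1))) (μ lam : Fin (3 + 1)) (z : Fin (3 + 1) → ℤ),
    ‖(((kerLap ((F.P K₀).L ^ (k + 1)) μ lam ((fun j => ((a j : ℕ) : ℤ)) + (((F.P K₀).L ^ (k + 1) : ℕ) : ℤ) • z)).re : ℝ) : ℂ)‖ ≤
      C * (F.P K₀).eta (k + 1) ^ 2 * Real.exp (-(δ * supNorm z)) := by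
  obtain ⟨δ, hδ, C, hC, hrowall⟩ := abs_lapStencil_windowResp_univ_le F
  refine ⟨δ, hδ, C, hC, fun K₀ k a μ lam z => ?_⟩
  refine norm_le_of_rows (F := F) (k := k)
    (fun z => (((kerLap ((F.P K₀).L ^ (k + 1)) μ lam ((fun j => ((a j : ℕ) : ℤ)) + (((F.P K₀).L ^ (k + 1) : ℕ) : ℤ) • z)).re : ℝ) : ℂ))
    (norm_re_kerLap_crude ((F.P K₀).L ^ (k + 1)) μ lam a) z fun K' hk2 hz => ?_
  obtain ⟨x, hx, hdist⟩ := realised_config (F := F) hk2 a z hz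
  have hk : k + 1 ≤ (F.P K').m + (F.P K').K := Nat.le_of_succ_le hk2
  have hval := lapStencil_windowResp_univ_eq F hk lam (0 : Site (F.P K') (k + 1)) x μ
    ((fun j => ((a j : ℕ) : ℤ)) + (((F.P K').L ^ (k + 1) : ℕ) : ℤ) • z) hx
  have S := summable_imgKer_translate_record F (K := K') (k := k) lam (0 : Site (F.P K') (k + 1)) μ
    ((fun j => ((a j : ℕ) : ℤ)) + (((F.P K').L ^ (k + 1) : ℕ) : ℤ) • z)
  have hsum := (summable_sum (s := (Finset.univ : Finset (Fin (3 + 1)))) fun ν _ =>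
    ((S (unitVec ν) (fun i => (abs_unitVec_le ν i).1)).sub ((S 0 abs_zero_step_le).mul_left 2)).add
      (S (-unitVec ν) (fun i => (abs_unitVec_le ν i).2)))
  have hsum' : Summable fun m : Fin (3 + 1) → ℤ => kerLap ((F.P K').L ^ (k + 1)) μ lam
      (translate (fine (d := 3 + 1) ((F.P K').L ^ (k + 1)) (Mk (F.P K') (k + 1)))
        ((fun j => ((a j : ℕ) : ℤ)) + (((F.P K').L ^ (k + 1) : ℕ) : ℤ) • z + 0 -
          (((F.P K').L ^ (k + 1) : ℕ) : ℤ) • rep (d := 3 + 1) (Mk (F.P K') (k + 1)) (0 : Site (F.P K') (k + 1))) m) := by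
    refine hsum.congr fun m => ?_
    simp only [kerLap, translate_shift_eq, add_zero]
    simp only [sub_eq_add_neg]
  have hval' := hval
  rw [show (fun j => ((a j : ℕ) : ℤ)) + (((F.P K').L ^ (k + 1) : ℕ) : ℤ) • z - (((F.P K').L ^ (k + 1) : ℕ) : ℤ) • rep (d := 3 + 1) (Mk (F.P K') (k + 1)) (0 : Site (F.P K') (k + 1)) =
      (fun j => ((a j : ℕ) : ℤ)) + (((F.P K').L ^ (k + 1) : ℕ) : ℤ) • z + 0 - (((F.P K').L ^ (k + 1) : ℕ) : ℤ) • rep (d := 3 + 1) (Mk (F.P K') (k + 1)) (0 : Site (F.P K') (k + 1))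
      by rw [add_zero]] at hval'
  have hper := tsum_re_eq_of_stencil F (kerLap ((F.P K').L ^ (k + 1)) μ lam) (fun j => ((a j : ℕ) : ℤ)) z _ hval' hsum'
  have hrow := hrowall K' k hk2 (lam, (0 : Site (F.P K') (k + 1))) ⟨x, μ⟩
  dsimp only at hrow
  rw [hdist] at hrow
  have hfinal : ‖((∑ ν : Fin (3 + 1), (windowResp F k K' Finset.univ (lam, (0 : Site (F.P K') (k + 1))) ⟨x.shift ν, μ⟩ -
      2 * windowResp F k K' Finset.univ (lam, (0 : Site (F.P K') (k + 1))) ⟨x, μ⟩ +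
      windowResp F k K' Finset.univ (lam, (0 : Site (F.P K') (k + 1))) ⟨x.unshift ν, μ⟩) : ℝ) : ℂ)‖ ≤
      C * (F.P K₀).eta (k + 1) ^ 2 * Real.exp (-(δ * supNorm z)) := by
    rw [Complex.norm_real, Real.norm_eq_abs]
    exact hrow
  exact (le_of_eq (congrArg _ hper)).trans hfinal

/-- ★★★ **THE INFINITE-VOLUME CURL (`∂*∂`) KERNEL DECAYS AT RATE `η²`**: with the constants `δ > 0`, `C ≥ 0` of ✓`abs_curlCurl_windowResp_univ_le` (r03's [B6] (2.148)∕(2.150) rows,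
volume-uniform), `|Re kerCurl n μ λ (a + n·z)| ≤ C·η²·e^{−δ|z|_∞}` for every `k`, offset `a`, directions, `z ∈ ℤ⁴`.
[cite: Balaban1985Variational, (137) p.298, (190) p.308; Balaban1984PropagatorsII, (2.148)-(2.150) p.249; Balaban1984PropagatorsI, p.36 ll.20–23] -/
theorem norm_re_kerCurl_le : ∃ δ : ℝ, 0 < δ ∧ ∃ C : ℝ, 0 ≤ C ∧ ∀ (K₀ k : ℕ) (a : Fin (3 + 1) → Fin ((F.P K₀).L ^ (k + 1))) (μ lam : Fin (3 + 1)) (z : Fin (3 + 1) → ℤ),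
    ‖(((kerCurl ((F.P K₀).L ^ (k + 1)) μ lam ((fun j => ((a j : ℕ) : ℤ)) + (((F.P K₀).L ^ (k + 1) : ℕ) : ℤ) • z)).re : ℝ) : ℂ)‖ ≤
      C * (F.P K₀).eta (k + 1) ^ 2 * Real.exp (-(δ * supNorm z)) := by
  obtain ⟨δ, hδ, C, hC, hrowall⟩ := abs_curlCurl_windowResp_univ_le F
  refine ⟨δ, hδ, C, hC, fun K₀ k a μ lam z => ?_⟩
  refine norm_le_of_rows (F := F) (k := k)
    (fun z => (((kerCurl ((F.P K₀).L ^ (k + 1)) μ lam ((fun j => ((a j : ℕ) : ℤ)) + (((F.P K₀).L ^ (k + 1) : ℕ) : ℤ) • z)).re : ℝ) : ℂ))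
    (norm_re_kerCurl_crude ((F.P K₀).L ^ (k + 1)) μ lam a) z fun K' hk2 hz => ?_
  obtain ⟨x, hx, hdist⟩ := realised_config (F := F) hk2 a z hz
  have hk : k + 1 ≤ (F.P K').m + (F.P K').K := Nat.le_of_succ_le hk2
  have hval := curlStencil_windowResp_univ_eq F hk lam (0 : Site (F.P K') (k + 1)) x μ
    ((fun j => ((a j : ℕ) : ℤ)) + (((F.P K').L ^ (k + 1) : ℕ) : ℤ) • z) hx
  have S := fun (μ' : Fin (3 + 1)) (s : Fin (3 + 1) → ℤ) (hs : ∀ i, |s i| ≤ 2) =>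
    summable_imgKer_translate_record F (K := K') (k := k) lam (0 : Site (F.P K') (k + 1)) μ'
      ((fun j => ((a j : ℕ) : ℤ)) + (((F.P K').L ^ (k + 1) : ℕ) : ℤ) • z) s hs
  have s0 : ∀ i : Fin (3 + 1), |(0 : Fin (3 + 1) → ℤ) i| ≤ 2 := abs_zero_step_le
  have s1 : ∀ ν i : Fin (3 + 1), |unitVec ν i| ≤ 2 := fun ν i => (abs_unitVec_le ν i).1
  have s2 : ∀ ν i : Fin (3 + 1), |(-unitVec ν) i| ≤ 2 := fun ν i => (abs_unitVec_le ν i).2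
  have s3 : ∀ ν i : Fin (3 + 1), |(-unitVec ν + unitVec μ) i| ≤ 2 := fun ν i => (abs_unitVec_add_le ν μ i).1
  have s4 : ∀ ν i : Fin (3 + 1), |(-unitVec ν + unitVec ν) i| ≤ 2 := fun ν i => (abs_unitVec_add_le ν ν i).2
  have hsum := (summable_sum (s := (Finset.univ : Finset (Fin (3 + 1)))) fun ν _ =>
    ((((S μ 0 s0).add (S ν _ (s1 μ))).sub (S μ _ (s1 ν))).sub (S ν 0 s0)).sub
      ((((S μ _ (s2 ν)).add (S ν _ (s3 ν))).sub (S μ _ (s4 ν))).sub (S ν _ (s2 ν))))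
  have hsum' : Summable fun m : Fin (3 + 1) → ℤ => kerCurl ((F.P K').L ^ (k + 1)) μ lam
      (translate (fine (d := 3 + 1) ((F.P K').L ^ (k + 1)) (Mk (F.P K') (k + 1)))
        ((fun j => ((a j : ℕ) : ℤ)) + (((F.P K').L ^ (k + 1) : ℕ) : ℤ) • z + 0 -
          (((F.P K').L ^ (k + 1) : ℕ) : ℤ) • rep (d := 3 + 1) (Mk (F.P K') (k + 1)) (0 : Site (F.P K') (k + 1))) m) := by
    refine hsum.congr fun m => ?_
    simp only [kerCurl, translate_shift_eq, add_zero]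
    simp only [sub_eq_add_neg, add_assoc]
  have hval' := hval
  rw [show (fun j => ((a j : ℕ) : ℤ)) + (((F.P K').L ^ (k + 1) : ℕ) : ℤ) • z - (((F.P K').L ^ (k + 1) : ℕ) : ℤ) • rep (d := 3 + 1) (Mk (F.P K') (k + 1)) (0 : Site (F.P K') (k + 1)) =
      (fun j => ((a j : ℕ) : ℤ)) + (((F.P K').L ^ (k + 1) : ℕ) : ℤ) • z + 0 - (((F.P K').L ^ (k + 1) : ℕ) : ℤ) • rep (d := 3 + 1) (Mk (F.P K') (k + 1)) (0 : Site (F.P K') (k + 1))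
      by rw [add_zero]] at hval'
  have hper := tsum_re_eq_of_stencil F (kerCurl ((F.P K').L ^ (k + 1)) μ lam) (fun j => ((a j : ℕ) : ℤ)) z _ hval' hsum'
  have hrow := hrowall K' k hk2 (lam, (0 : Site (F.P K') (k + 1))) ⟨x, μ⟩
  dsimp only at hrow
  rw [hdist] at hrow
  -- the token stencil IS `∂*₁∂₁` of the response (✓`curlStencil_eq_dcsE_dcE`)
  have hid := curlStencil_eq_dcsE_dcE (P := F.P K') (WithLp.toLp 2 (windowResp F k K' Finset.univ (lam, (0 : Site (F.P K') (k + 1))))) ⟨x, μ⟩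
  have hfinal : ‖((∑ ν : Fin (3 + 1), ((windowResp F k K' Finset.univ (lam, (0 : Site (F.P K') (k + 1))) ⟨x, μ⟩ +
        windowResp F k K' Finset.univ (lam, (0 : Site (F.P K') (k + 1))) ⟨x.shift μ, ν⟩ -
        windowResp F k K' Finset.univ (lam, (0 : Site (F.P K') (k + 1))) ⟨x.shift ν, μ⟩ -
        windowResp F k K' Finset.univ (lam, (0 : Site (F.P K') (k + 1))) ⟨x, ν⟩) -
      (windowResp F k K' Finset.univ (lam, (0 : Site (F.P K') (k + 1))) ⟨x.unshift ν, μ⟩ +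
        windowResp F k K' Finset.univ (lam, (0 : Site (F.P K') (k + 1))) ⟨(x.unshift ν).shift μ, ν⟩ -
        windowResp F k K' Finset.univ (lam, (0 : Site (F.P K') (k + 1))) ⟨(x.unshift ν).shift ν, μ⟩ -
        windowResp F k K' Finset.univ (lam, (0 : Site (F.P K') (k + 1))) ⟨x.unshift ν, ν⟩)) : ℝ) : ℂ)‖ ≤
      C * (F.P K₀).eta (k + 1) ^ 2 * Real.exp (-(δ * supNorm z)) := by
    rw [Complex.norm_real, Real.norm_eq_abs]
    have hid' : (∑ ν : Fin (3 + 1), ((windowResp F k K' Finset.univ (lam, (0 : Site (F.P K') (k + 1))) ⟨x, μ⟩ +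
        windowResp F k K' Finset.univ (lam, (0 : Site (F.P K') (k + 1))) ⟨x.shift μ, ν⟩ -
        windowResp F k K' Finset.univ (lam, (0 : Site (F.P K') (k + 1))) ⟨x.shift ν, μ⟩ -
        windowResp F k K' Finset.univ (lam, (0 : Site (F.P K') (k + 1))) ⟨x, ν⟩) -
      (windowResp F k K' Finset.univ (lam, (0 : Site (F.P K') (k + 1))) ⟨x.unshift ν, μ⟩ +
        windowResp F k K' Finset.univ (lam, (0 : Site (F.P K') (k + 1))) ⟨(x.unshift ν).shift μ, ν⟩ -
        windowResp F k K' Finset.univ (lam, (0 : Site (F.P K') (k + 1))) ⟨(x.unshift ν).shift ν, μ⟩ -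
        windowResp F k K' Finset.univ (lam, (0 : Site (F.P K') (k + 1))) ⟨x.unshift ν, ν⟩))) =
        dcsE 1 (dcE 1 (WithLp.toLp 2 (windowResp F k K' Finset.univ (lam, (0 : Site (F.P K') (k + 1)))))) ⟨x, μ⟩ := hid
    rw [hid']
    exact hrow
  exact (le_of_eq (congrArg _ hper)).trans hfinal

end Summit.QuantumFields.YangMills.Theorems.PortU8.Images

end
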